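import Literature.Probability.RandomPlanarGeometry.SAWCountStepWords
import HarnessLib

/-!
# Self-avoiding walks on `ℤ^d` as step words (lists of letters `Fin d × Bool`)

Topic `Literature/Probability/RandomPlanarGeometry` (the `d`-dimensional twin of `SAWWords.lean`, which does `ℤ²` with the
alphabet `Fin 4`).  A nearest-neighbour walk on `ℤ^d` from the origin is recorded by its STEP WORD `w : List (Fin d × Bool)`
(letter `(i, b)` = the unit step `± eᵢ`, `stepVec` of the percolation files).  This is the executable model used by the certified
finite-memory computations bounding the connective constant `μ(d)` (`SAWWordAutomataZd.lean`, `SAWFiniteMemoryZ3.lean`):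
everything here is computable and decidable.

## Contents (namespace `Literature.Probability.RandomPlanarGeometry.SAW.Zd.Word`)

* `wEnd w` (endpoint), `traj w : ℕ → ℤ^d` (position after `i` steps, frozen after `|w|`), `IsSAW w` (decidable: the `|w|+1`
  visited sites are distinct), `words d n` (all `(2d)ⁿ` words), `sawWords d n`;
* prefix / suffix / concatenation lemmas (`IsSAW.take`, `IsSAW.drop`, `traj_append_left/right`);
* the bridge to the tree's other encodings: `traj_ofFn : traj (List.ofFn w) = wordPos w` (step words as functions
  `Fin n → Fin d × Bool`, `Percolation.sawWords`), `sawWords_eq_image`, and **`card_sawWords : #(sawWords d n) = cₙ`**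
  (`= SAW.Zd.count d n`, through `card_sawWords_eq_count` of `SAWCountStepWords.lean`; Madras–Slade §1.1).

References: N. Madras, G. Slade, *The Self-Avoiding Walk* (1993), §1.1 [MadrasSlade1993].
-/

open Finset Literature.Probability.LatticeModels Literature.Probability.Percolation SimpleGraph
open scoped BigOperators

namespace Literature.Probability.RandomPlanarGeometry.SAW.Zd

namespace Word

variable {d : ℕ}

/-! ### Endpoints and trajectories -/

/-- Endpoint of the walk with step word `w` started at the origin. [folklore] -/
def wEnd (w : List (Fin d × Bool)) : Site d := (w.map stepVec).sum

/-- `wEnd [] = 0`. [cite: MadrasSlade1993, §1.1] -/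
@[simp] theorem wEnd_nil : wEnd ([] : List (Fin d × Bool)) = 0 := rfl

/-- `wEnd (w ++ w') = wEnd w + wEnd w'`. [cite: MadrasSlade1993, §1.1] -/
@[simp] theorem wEnd_append (w w' : List (Fin d × Bool)) : wEnd (w ++ w') = wEnd w + wEnd w' := by
  simp [wEnd, List.sum_append]

/-- `wEnd [a] = stepVec a`. [cite: MadrasSlade1993, §1.1] -/
@[simp] theorem wEnd_singleton (a : Fin d × Bool) : wEnd [a] = stepVec a := by simp [wEnd]

/-- `wEnd (a :: w) = stepVec a + wEnd w`. [cite: MadrasSlade1993, §1.1] -/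
@[simp] theorem wEnd_cons (a : Fin d × Bool) (w : List (Fin d × Bool)) : wEnd (a :: w) = stepVec a + wEnd w := by
  simp [wEnd]

/-- The vertex function of the word `w`: position after `i` steps, frozen at the endpoint for `i ≥ |w|`.
[cite: MadrasSlade1993, §1.1] -/
def traj (w : List (Fin d × Bool)) (i : ℕ) : Site d := wEnd (w.take i)

/-- The walk starts at the origin. [cite: MadrasSlade1993, §1.1] -/
@[simp] theorem traj_zero (w : List (Fin d × Bool)) : traj w 0 = 0 := by simp [traj]

/-- One step of the walk: `traj w (i+1) = traj w i + stepVec w[i]`. [cite: MadrasSlade1993, §1.1] -/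
theorem traj_succ (w : List (Fin d × Bool)) {i : ℕ} (hi : i < w.length) :
    traj w (i + 1) = traj w i + stepVec (w[i]) := by
  rw [traj, traj, List.take_succ_eq_append_getElem hi, wEnd_append, wEnd_singleton]

/-- The walk is frozen from time `|w|` on. [cite: MadrasSlade1993, §1.1] -/
theorem traj_of_le (w : List (Fin d × Bool)) {i : ℕ} (hi : w.length ≤ i) : traj w i = wEnd w := by
  simp [traj, List.take_of_length_le hi]

/-- At time `|w|` the walk is at its endpoint. [cite: MadrasSlade1993, §1.1] -/
@[simp] theorem traj_length (w : List (Fin d × Bool)) : traj w w.length = wEnd w := traj_of_le w le_rfl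

/-- The trajectory of a prefix agrees with the original up to its length. [cite: MadrasSlade1993, §1.1] -/
theorem traj_take (w : List (Fin d × Bool)) {i k : ℕ} (hik : i ≤ k) : traj (w.take k) i = traj w i := by
  simp [traj, List.take_take, min_eq_left hik]

/-- The trajectory of `w ++ w'` up to time `|w|` is that of `w`. [cite: MadrasSlade1993, §1.1] -/
theorem traj_append_left (w w' : List (Fin d × Bool)) {i : ℕ} (hi : i ≤ w.length) :
    traj (w ++ w') i = traj w i := by
  simp [traj, List.take_append_of_le_length hi]

/-- The trajectory of `w ++ w'` after time `|w|` is the translate of that of `w'`. [cite: MadrasSlade1993, §1.1] -/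
theorem traj_append_right (w w' : List (Fin d × Bool)) (i : ℕ) :
    traj (w ++ w') (w.length + i) = wEnd w + traj w' i := by
  simp [traj, List.take_append, List.take_of_length_le (Nat.le_add_right w.length i)]

/-- Consecutive positions are adjacent in `ℤ^d`. [cite: MadrasSlade1993, §1.1] -/
theorem adj_traj_succ (w : List (Fin d × Bool)) {i : ℕ} (hi : i < w.length) :
    (zdGraph d).Adj (traj w i) (traj w (i + 1)) := by
  rw [traj_succ w hi, zdGraph_adj_iff_stepVec]
  exact ⟨_, rfl⟩

/-! ### Self-avoiding words -/

/-- The list of the `|w| + 1` sites visited by `w`. [folklore] -/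
def verts (w : List (Fin d × Bool)) : List (Site d) := (List.range (w.length + 1)).map (traj w)

/-- **Self-avoiding word**: the `|w| + 1` visited sites are distinct. Decidable. [cite: MadrasSlade1993, Definition 1.1.1] -/
def IsSAW (w : List (Fin d × Bool)) : Prop := (verts w).Nodup

/-- Self-avoidance of a word is decidable. [folklore] -/
instance (w : List (Fin d × Bool)) : Decidable (IsSAW w) := inferInstanceAs (Decidable (verts w).Nodup)

/-- Self-avoidance as injectivity of the trajectory on `[0, |w|]`. [cite: MadrasSlade1993, §1.1] -/
theorem isSAW_iff_injOn (w : List (Fin d × Bool)) : IsSAW w ↔ Set.InjOn (traj w) {i | i ≤ w.length} := by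
  rw [IsSAW, verts, List.nodup_map_iff_inj_on List.nodup_range]
  constructor
  · intro h i hi j hj hij
    exact h i (List.mem_range.2 (Nat.lt_succ_of_le hi)) j (List.mem_range.2 (Nat.lt_succ_of_le hj)) hij
  · intro h i hi j hj hij
    exact h (Nat.le_of_lt_succ (List.mem_range.1 hi)) (Nat.le_of_lt_succ (List.mem_range.1 hj)) hij

/-- The empty word is self-avoiding. [cite: MadrasSlade1993, §1.1] -/
theorem isSAW_nil : IsSAW ([] : List (Fin d × Bool)) := by
  rw [isSAW_iff_injOn]
  intro i hi j hj _
  simp only [List.length_nil, Set.mem_setOf_eq, Nat.le_zero] at hi hj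
  rw [hi, hj]

/-- A prefix of a self-avoiding word is self-avoiding. [cite: MadrasSlade1993, §1.1] -/
theorem IsSAW.take {w : List (Fin d × Bool)} (h : IsSAW w) (k : ℕ) : IsSAW (w.take k) := by
  rw [isSAW_iff_injOn] at h ⊢
  intro i hi j hj hij
  simp only [Set.mem_setOf_eq, List.length_take] at hi hj
  have hi' : i ≤ k := le_trans hi (min_le_left _ _)
  have hj' : j ≤ k := le_trans hj (min_le_left _ _)
  rw [traj_take w hi', traj_take w hj'] at hij
  exact h (le_trans hi (min_le_right _ _)) (le_trans hj (min_le_right _ _)) hij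

/-- A suffix of a self-avoiding word is self-avoiding (translation invariance). [cite: MadrasSlade1993, §1.1] -/
theorem IsSAW.drop {w : List (Fin d × Bool)} (h : IsSAW w) (k : ℕ) : IsSAW (w.drop k) := by
  rcases le_or_gt k w.length with hk | hk
  · rw [isSAW_iff_injOn] at h ⊢
    intro i hi j hj hij
    simp only [Set.mem_setOf_eq, List.length_drop] at hi hj
    have hlen : (w.take k).length = k := by simp [min_eq_left hk]
    have key : ∀ m, traj w (k + m) = wEnd (w.take k) + traj (w.drop k) m := fun m => by
      have := traj_append_right (w.take k) (w.drop k) m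
      rwa [List.take_append_drop, hlen] at this
    have := h (show k + i ≤ w.length by omega) (show k + j ≤ w.length by omega)
      (by rw [key, key, hij])
    omega
  · rw [List.drop_of_length_le hk.le]
    exact isSAW_nil

/-! ### The finite sets of words -/

/-- All `(2d)ⁿ` step words of length `n`. [folklore] -/
def words (d n : ℕ) : Finset (List (Fin d × Bool)) :=
  (Finset.univ : Finset (Fin n → Fin d × Bool)).image List.ofFn

/-- Membership in `words d n` is having length `n`. [cite: MadrasSlade1993, §1.1] -/
@[simp] theorem mem_words {n : ℕ} {w : List (Fin d × Bool)} : w ∈ words d n ↔ w.length = n := by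
  simp only [words, Finset.mem_image, Finset.mem_univ, true_and]
  constructor
  · rintro ⟨f, rfl⟩; simp
  · intro h; subst h; exact ⟨fun i => w[i], List.ofFn_getElem⟩

/-- `#(words d n) = (2d)ⁿ`. [cite: MadrasSlade1993, §1.1] -/
theorem card_words (d n : ℕ) : (words d n).card = (2 * d) ^ n := by
  rw [words, Finset.card_image_of_injective _ List.ofFn_injective]
  simp [mul_comm]

/-- The self-avoiding words of length `n`. [cite: MadrasSlade1993, Definition 1.1.1] -/
def sawWords (d n : ℕ) : Finset (List (Fin d × Bool)) := (words d n).filter IsSAW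

/-- Membership in `sawWords d n`. [cite: MadrasSlade1993, §1.1] -/
@[simp] theorem mem_sawWords {n : ℕ} {w : List (Fin d × Bool)} : w ∈ sawWords d n ↔ w.length = n ∧ IsSAW w := by
  simp [sawWords]

/-- `sawWords (n+1)` splits off the last step: every word of `sawWords d (n + 1)` is `w ++ [a]` with `w ∈ sawWords d n`.
[cite: MadrasSlade1993, §1.1] -/
theorem mem_sawWords_succ {n : ℕ} {w : List (Fin d × Bool)} (h : w ∈ sawWords d (n + 1)) :
    ∃ w' ∈ sawWords d n, ∃ a : Fin d × Bool, w = w' ++ [a] := by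
  obtain ⟨hl, hs⟩ := mem_sawWords.1 h
  refine ⟨w.take n, mem_sawWords.2 ⟨by simp [hl], hs.take n⟩, w[n]'(by omega), ?_⟩
  conv_lhs => rw [← List.take_append_drop n w]
  rw [List.drop_eq_getElem_cons (by omega), List.drop_of_length_le (by omega)]

/-! ### The bridge to the function-indexed step words of the percolation files -/

/-- **The trajectory of `List.ofFn w` is the `wordPos` of `w`** (`w : Fin n → Fin d × Bool`). [cite: MadrasSlade1993, §1.1] -/
theorem traj_ofFn {n : ℕ} (w : Fin n → Fin d × Bool) (i : ℕ) : traj (List.ofFn w) i = wordPos w i := by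
  have key : ∀ i ≤ n, traj (List.ofFn w) i = wordPos w i := by
    intro i hi
    induction i with
    | zero => simp
    | succ i ih =>
      rw [traj_succ _ (by simp; omega), ih (by omega), wordPos_succ w (show i < n by omega), List.getElem_ofFn]
  rcases le_or_gt i n with hi | hi
  · exact key i hi
  · rw [traj_of_le _ (by simp; omega), ← traj_length, List.length_ofFn, key n le_rfl, SAW.Zd.wordPos_of_le w hi.le]

/-- **A word is self-avoiding iff its letter function is** (`Percolation.IsSAW`). [cite: MadrasSlade1993, §1.1] -/
theorem isSAW_ofFn_iff {n : ℕ} (w : Fin n → Fin d × Bool) : IsSAW (List.ofFn w) ↔ Percolation.IsSAW w := by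
  rw [isSAW_iff_injOn, List.length_ofFn]
  constructor
  · intro h i j hi hj hij
    exact h hi hj (by rw [traj_ofFn, traj_ofFn]; exact hij)
  · intro h i hi j hj hij
    exact h i j hi hj (by rw [← traj_ofFn, ← traj_ofFn]; exact hij)

/-- `sawWords d n` is the image of `Percolation.sawWords d n` under `List.ofFn`. [cite: MadrasSlade1993, §1.1] -/
theorem sawWords_eq_image (d n : ℕ) : sawWords d n = (Percolation.sawWords d n).image List.ofFn := by
  ext w
  simp only [mem_sawWords, Finset.mem_image, Percolation.mem_sawWords]
  constructor
  · rintro ⟨hl, hs⟩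
    subst hl
    have e : List.ofFn (fun i : Fin w.length => w[i]) = w := List.ofFn_getElem
    refine ⟨fun i => w[i], ?_, e⟩
    rw [← isSAW_ofFn_iff, e]
    exact hs
  · rintro ⟨f, hf, rfl⟩
    exact ⟨List.length_ofFn, (isSAW_ofFn_iff f).2 hf⟩

/-- **`#(sawWords d n) = cₙ`**: self-avoiding step words of length `n` are in bijection with the `n`-step self-avoiding walks
from the origin counted by `SAW.Zd.count d n`. [cite: MadrasSlade1993, §1.1] -/
theorem card_sawWords (d n : ℕ) : (sawWords d n).card = count d n := by
  rw [sawWords_eq_image, Finset.card_image_of_injective _ List.ofFn_injective, card_sawWords_eq_count]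

end Word

end Literature.Probability.RandomPlanarGeometry.SAW.Zd
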